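import Summits.ABC.ABC.Theorems.CubicResolventAllowanceResolventDiscBoundsCaps
import Mathlib.FieldTheory.PrimitiveElement
import Mathlib.FieldTheory.Extension
import Mathlib.NumberTheory.Padics.PadicVal.Basic
import Mathlib.Data.Nat.Factorization.Basic

/-!
# Ramification and the discriminant of a number field: support, towers, subfields of prime degree

Generic algebraic number theory and field theory (no elliptic curve in this file), written as the
E-independent toolkit behind the resolvent-field discriminant bounds `|d_K| ≤ 1944·N²` /
`|d_K| ≤ 8·N` of route CubicResolventAllowance (item `ResolventDiscBounds`, stmt-ABC-22743, closed by
`resolventDiscBounds_proof` with E-specific engines phrased over `W.divisionField 2`), and reusable by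
any conductor ↔ discriminant argument over a division field. For a number field `K`,
`d_K = NumberField.discr K`:

* §1 Dedekind's discriminant theorem in RAMIFICATION-INDEX language,
  `not_dvd_discr_iff_forall_ramificationIdx_eq_one : ¬ p ∣ d_K ↔ ∀ P ∋ p maximal, e(P|p) = 1` — a
  bridge from Mathlib's `NumberField.not_dvd_discr_iff_forall_mem` (stated with
  `Algebra.IsUnramifiedAt`) via `Ideal.ramificationIdx_eq_one_iff`, i.e. in the vocabulary of the
  tree's Néron–Ogg–Shafarevich theorems; one-directional corollaries and the valuation form.
* §2 towers `K ⊆ L`: a ramified prime of `K` lies under a ramified prime of `L`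
  (`exists_ramificationIdx_ne_one_tower`: `e(Q|p) = e(P|p)·e(Q|P)`, Mathlib
  `Ideal.ramificationIdx_below_le`), hence `not_dvd_discr_of_forall_ramificationIdx_eq_one_of_algebra`:
  if every prime of `L` above `p` is unramified over `ℤ` then `p ∤ d_K` for every subfield `K`
  (equivalently via Mathlib `NumberField.discr_dvd_discr`).
* §3 the `ℕ`-packaging `dvd_mul_sq_of_padicValNat_le` (`v₂ d ≤ 3`, `v₃ d ≤ 5`, `v_p d ≤ 2` and
  `p ∣ d ⇒ p ∣ N` for `p ≥ 5` give `d ∣ 1944·N²`, `1944 = 2³·3⁵`) and `dvd_mul_of_padicValNat_le`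
  (`v₂ d ≤ 3`, `v_p d ≤ 1` and `p ∣ d ⇒ p ∣ N` for `p ≥ 3` give `d ∣ 8·N`).
* §4 engines over an arbitrary number field `L ⊇ K` and an arbitrary modulus `N`:
  `abs_discr_le_of_cubic_of_unramified` / `abs_discr_le_of_quadratic_of_unramified` — `[K:ℚ] = 3`
  (resp. `2`) and "for every prime `p ≥ 5` (resp. `p ≥ 3`) not dividing `N`, every prime of `L` above
  `p` is unramified" give `|d_K| ≤ 1944·N²` (resp. `≤ 8·N`), using the valuation caps of
  `CubicResolventAllowanceResolventDiscBoundsCaps` (`v_p(d_K) ≤ [K:ℚ]-1` for `p > [K:ℚ]`,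
  `v₂ ≤ 3`, `v₃ ≤ 5` for `[K:ℚ] ≤ 3`).
* §5 the abstract embedding `nonempty_algHom_of_finrank_prime`: a number field of PRIME degree
  embeds over `ℚ` into every field over which some nonzero polynomial killing an irrational element
  of it splits (`IntermediateField.isSimpleOrder_of_finrank_prime` + extension of embeddings);
  `ne_algebraMap_of_irreducible`.
* §6 `abs_discr_le_of_cubic_root` / `abs_discr_le_of_quadratic_root`: §4 ∘ §5, hypotheses in the
  shape of the two clauses of `ResolventDiscBounds` but with `(L, N)` abstract — the consumer supplies
  `L = ℚ(E[n])`, the splitting of the division polynomial in `L`, and unramifiedness of `L` at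
  `p ∤ n·N` (Néron–Ogg–Shafarevich).

No conjecture is involved and nothing here is specific to abc (the consuming line's payoff is a
class-window row under A-PS; A-PS is NOT abc).

References: J. Neukirch, *Algebraic Number Theory* (1999), Ch. I (8.2), Ch. III (2.6), (2.9), (2.11);
S. Lang, *Algebra* (2002), Ch. V §2 (extension of embeddings).
-/

-- `Summit.<Summit>.<Problem>` is the mandated summit-side namespace (CONVENTIONS §2); for the
-- single-conjunct summit `ABC` the two coincide, so the duplicate `ABC.ABC` is deliberate.
set_option linter.dupNamespace false

noncomputable section

namespace Summit.ABC.ABC.Theorems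

open NumberField Ideal Polynomial

variable (K : Type*) [Field K] [NumberField K]

/-! ### §1. Ramification and the support of the discriminant -/

/-- **Dedekind's discriminant theorem in ramification-index language** (bridge to Mathlib's
`NumberField.not_dvd_discr_iff_forall_mem`, which speaks `Algebra.IsUnramifiedAt`): for a rational
prime `p`, `p ∤ d_K` iff every maximal ideal `P ∋ p` of `𝓞 K` has `e(P|p) = 1`. The translation is
Mathlib's `Ideal.ramificationIdx_eq_one_iff` (residue fields of `ℤ` are perfect). This is the
vocabulary of the tree's Néron–Ogg–Shafarevich statements (`ramificationIdx … = 1`).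
[cite: NeukirchANT1999, Ch. III (2.11)] -/
theorem not_dvd_discr_iff_forall_ramificationIdx_eq_one {p : ℕ} (hp : p.Prime) :
    ¬ (p : ℤ) ∣ discr K ↔
      ∀ (P : Ideal (𝓞 K)) [P.IsMaximal], (p : 𝓞 K) ∈ P → P.ramificationIdx ℤ = 1 := by
  rw [NumberField.not_dvd_discr_iff_forall_mem K (𝓞 K) (Nat.prime_iff_prime_int.mp hp)]
  refine ⟨fun H P hP hmem => ?_, fun H P hP hmem => ?_⟩
  · exact Ideal.ramificationIdx_eq_one_iff.mpr (H P hP.isPrime (by simpa using hmem))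
  · have hne : P ≠ ⊥ := by
      intro h
      rw [h, Ideal.mem_bot, Int.cast_natCast, Nat.cast_eq_zero] at hmem
      exact hp.ne_zero hmem
    haveI : P.IsMaximal := hP.isMaximal hne
    exact Ideal.ramificationIdx_eq_one_iff.mp (H P (by simpa using hmem))

/-- **Unramified primes do not divide the discriminant**: if every maximal ideal `P ∋ p` of `𝓞 K`
has `e(P|p) = 1` then `p ∤ d_K`. [cite: NeukirchANT1999, Ch. III (2.11)] -/
theorem not_dvd_discr_of_forall_ramificationIdx_eq_one {p : ℕ} (hp : p.Prime)
    (h : ∀ (P : Ideal (𝓞 K)) [P.IsMaximal], (p : 𝓞 K) ∈ P → P.ramificationIdx ℤ = 1) :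
    ¬ (p : ℤ) ∣ discr K :=
  (not_dvd_discr_iff_forall_ramificationIdx_eq_one K hp).mpr h

/-- Valuation form: if every maximal ideal `P ∋ p` of `𝓞 K` has `e(P|p) = 1` then `v_p(|d_K|) = 0`.
[cite: NeukirchANT1999, Ch. III (2.11)] -/
theorem padicValNat_discr_eq_zero_of_forall_ramificationIdx_eq_one {p : ℕ} (hp : p.Prime)
    (h : ∀ (P : Ideal (𝓞 K)) [P.IsMaximal], (p : 𝓞 K) ∈ P → P.ramificationIdx ℤ = 1) :
    padicValNat p (discr K).natAbs = 0 :=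
  padicValNat.eq_zero_of_not_dvd fun hd =>
    not_dvd_discr_of_forall_ramificationIdx_eq_one K hp h (Int.natCast_dvd.mpr hd)

/-- **A prime dividing the discriminant ramifies**: `p ∣ d_K ⇒` some maximal ideal `P ∋ p` of `𝓞 K`
has `e(P|p) ≠ 1`. [cite: NeukirchANT1999, Ch. III (2.11)] -/
theorem exists_ramificationIdx_ne_one_of_dvd_discr {p : ℕ} (hp : p.Prime)
    (hd : (p : ℤ) ∣ discr K) :
    ∃ P : Ideal (𝓞 K), P.IsMaximal ∧ (p : 𝓞 K) ∈ P ∧ P.ramificationIdx ℤ ≠ 1 := by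
  by_contra hne
  push Not at hne
  exact not_dvd_discr_of_forall_ramificationIdx_eq_one K hp (fun P _ hmem => hne P ‹_› hmem) hd

/-- **Ramified primes divide the discriminant**: a maximal ideal `P ∋ p` of `𝓞 K` with `e(P|p) ≠ 1`
forces `p ∣ d_K` (the other direction of Dedekind's theorem). [cite: NeukirchANT1999, Ch. III (2.11)] -/
theorem dvd_discr_of_ramificationIdx_ne_one {p : ℕ} (hp : p.Prime) (P : Ideal (𝓞 K)) [P.IsMaximal]
    (hmem : (p : 𝓞 K) ∈ P) (hP : P.ramificationIdx ℤ ≠ 1) : (p : ℤ) ∣ discr K := by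
  by_contra hd
  exact hP ((not_dvd_discr_iff_forall_ramificationIdx_eq_one K hp).mp hd P hmem)

/-! ### §2. Towers -/

section Tower

variable (L : Type*) [Field L] [NumberField L] [Algebra K L]

/-- **Ramification persists up a tower.** For number fields `K ⊆ L` and a maximal ideal `P` of `𝓞 K`
ramified over `ℤ` (`e(P|p) ≠ 1`), some maximal ideal `Q` of `𝓞 L` lies over `P` and is ramified over
`ℤ`: `e(Q|p) = e(P|p)·e(Q|P) ≥ e(P|p) ≥ 2` (Mathlib `Ideal.ramificationIdx_below_le`, flatness of
`𝓞 L` over the Dedekind domain `𝓞 K`). [cite: NeukirchANT1999, Ch. I (8.2)] -/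
theorem exists_ramificationIdx_ne_one_tower (P : Ideal (𝓞 K)) [P.IsMaximal]
    (hP : P.ramificationIdx ℤ ≠ 1) :
    ∃ Q : Ideal (𝓞 L), Q.IsMaximal ∧ Q.LiesOver P ∧ Q.ramificationIdx ℤ ≠ 1 := by
  obtain ⟨Q, hQmax, hQover⟩ :=
    Ideal.exists_maximal_ideal_liesOver_of_isIntegral (S := 𝓞 L) P
  refine ⟨Q, hQmax, hQover, ?_⟩
  have hle : P.ramificationIdx ℤ ≤ Q.ramificationIdx ℤ := Ideal.ramificationIdx_below_le (R := ℤ) P Q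
  have hpos : 0 < P.ramificationIdx ℤ := Ideal.ramificationIdx_pos P ℤ
  omega

/-- **Discriminant support of a subfield.** For number fields `K ⊆ L` and a rational prime `p`: if
every maximal ideal `Q ∋ p` of `𝓞 L` is unramified over `ℤ` (`e(Q|p) = 1`), then `p ∤ d_K`. This is
the form in which "`ℚ(E[2])` is unramified at `p ∤ 2N`" controls the discriminant of the resolvent
fields `K ⊆ ℚ(E[2])`. [cite: NeukirchANT1999, Ch. III (2.11)] -/
theorem not_dvd_discr_of_forall_ramificationIdx_eq_one_of_algebra {p : ℕ} (hp : p.Prime)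
    (h : ∀ (Q : Ideal (𝓞 L)) [Q.IsMaximal], (p : 𝓞 L) ∈ Q → Q.ramificationIdx ℤ = 1) :
    ¬ (p : ℤ) ∣ discr K := by
  intro hd
  obtain ⟨P, hPmax, hpP, hP⟩ := exists_ramificationIdx_ne_one_of_dvd_discr K hp hd
  obtain ⟨Q, hQmax, hQover, hQ⟩ := exists_ramificationIdx_ne_one_tower K L P hP
  refine hQ (h Q ?_)
  have h1 : algebraMap (𝓞 K) (𝓞 L) (p : 𝓞 K) ∈ Q := by
    rw [← Ideal.mem_comap]
    change (p : 𝓞 K) ∈ Q.under (𝓞 K)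
    rwa [← hQover.over]
  simpa using h1

end Tower

/-! ### §3. Arithmetic packaging -/

/-- A prime is `2`, `3`, or at least `5`. [folklore] -/
theorem prime_eq_two_or_three_or_five_le {p : ℕ} (hp : p.Prime) : p = 2 ∨ p = 3 ∨ 5 ≤ p := by
  have h2 := hp.two_le
  have h4 : p ≠ 4 := by rintro rfl; exact absurd hp (by decide)
  omega

/-- `p ^ n ∣ a ≠ 0 ⇒ n ≤ v_p(a)` (Mathlib `padicValNat_dvd_iff_le` without the `Fact` instance).
[folklore] -/
theorem le_padicValNat_of_pow_dvd {p n a : ℕ} (hp : p.Prime) (ha : a ≠ 0) (h : p ^ n ∣ a) :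
    n ≤ padicValNat p a := by
  haveI := Fact.mk hp
  exact (padicValNat_dvd_iff_le ha).mp h

/-- **Arithmetic packaging, cubic case**: for `d, N ≠ 0`, if `v₂(d) ≤ 3`, `v₃(d) ≤ 5`, and every
prime `p ≥ 5` has `v_p(d) ≤ 2` and `p ∣ d ⇒ p ∣ N`, then `d ∣ 1944·N²` (`1944 = 2³·3⁵`; compare
valuations prime by prime, `Nat.factorization_prime_le_iff_dvd`). [folklore] -/
theorem dvd_mul_sq_of_padicValNat_le {d N : ℕ} (hd : d ≠ 0) (hN : N ≠ 0)
    (h2 : padicValNat 2 d ≤ 3) (h3 : padicValNat 3 d ≤ 5)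
    (h5 : ∀ p : ℕ, p.Prime → 5 ≤ p → padicValNat p d ≤ 2)
    (hs : ∀ p : ℕ, p.Prime → 5 ≤ p → p ∣ d → p ∣ N) :
    d ∣ 1944 * N ^ 2 := by
  have hM : 1944 * N ^ 2 ≠ 0 := by positivity
  refine (Nat.factorization_prime_le_iff_dvd hd hM).mp fun p hp => ?_
  rw [Nat.factorization_def _ hp, Nat.factorization_def _ hp]
  by_cases hpd : p ∣ d
  · rcases prime_eq_two_or_three_or_five_le hp with rfl | rfl | h5p
    · exact h2.trans (le_padicValNat_of_pow_dvd hp hM (Dvd.dvd.mul_right (by norm_num) _))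
    · exact h3.trans (le_padicValNat_of_pow_dvd hp hM (Dvd.dvd.mul_right (by norm_num) _))
    · refine (h5 p hp h5p).trans (le_padicValNat_of_pow_dvd hp hM ?_)
      exact Dvd.dvd.mul_left (pow_dvd_pow_of_dvd (hs p hp h5p hpd) 2) _
  · rw [padicValNat.eq_zero_of_not_dvd hpd]; exact Nat.zero_le _

/-- **Arithmetic packaging, quadratic case**: for `d, N ≠ 0`, if `v₂(d) ≤ 3` and every prime
`p ≥ 3` has `v_p(d) ≤ 1` and `p ∣ d ⇒ p ∣ N`, then `d ∣ 8·N`. [folklore] -/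
theorem dvd_mul_of_padicValNat_le {d N : ℕ} (hd : d ≠ 0) (hN : N ≠ 0)
    (h2 : padicValNat 2 d ≤ 3)
    (h3 : ∀ p : ℕ, p.Prime → 3 ≤ p → padicValNat p d ≤ 1)
    (hs : ∀ p : ℕ, p.Prime → 3 ≤ p → p ∣ d → p ∣ N) :
    d ∣ 8 * N := by
  have hM : 8 * N ≠ 0 := by positivity
  refine (Nat.factorization_prime_le_iff_dvd hd hM).mp fun p hp => ?_
  rw [Nat.factorization_def _ hp, Nat.factorization_def _ hp]
  by_cases hpd : p ∣ d
  · rcases prime_eq_two_or_three_or_five_le hp with rfl | rfl | h5p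
    · exact h2.trans (le_padicValNat_of_pow_dvd hp hM (Dvd.dvd.mul_right (by norm_num) _))
    · refine (h3 3 hp le_rfl).trans (le_padicValNat_of_pow_dvd hp hM ?_)
      rw [pow_one]; exact Dvd.dvd.mul_left (hs 3 hp le_rfl hpd) _
    · refine (h3 p hp (by omega)).trans (le_padicValNat_of_pow_dvd hp hM ?_)
      rw [pow_one]; exact Dvd.dvd.mul_left (hs p hp (by omega) hpd) _
  · rw [padicValNat.eq_zero_of_not_dvd hpd]; exact Nat.zero_le _

/-! ### §4. Engines -/

section Engine

variable (L : Type*) [Field L] [NumberField L] [Algebra K L]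

/-- `|d_K| ∣ M ≠ 0 ⇒ |(d_K : ℝ)| ≤ M` (cast bookkeeping for the route's real-valued statement).
[folklore] -/
theorem abs_discr_le_of_natAbs_dvd {M : ℕ} (hM : M ≠ 0) (h : (discr K).natAbs ∣ M) :
    |(discr K : ℝ)| ≤ (M : ℝ) := by
  have h1 : (discr K).natAbs ≤ M := Nat.le_of_dvd (Nat.pos_of_ne_zero hM) h
  have h2 : (|discr K| : ℤ) ≤ (M : ℤ) := by rw [← Int.natCast_natAbs]; exact_mod_cast h1
  have h3 := (Int.cast_le (R := ℝ)).mpr h2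
  simpa using h3

/-- **Cubic engine.** Let `K ⊆ L` be number fields with `[K:ℚ] = 3` and `N ≠ 0` a natural number
such that for every prime `p ≥ 5` with `p ∤ N` every maximal ideal `Q ∋ p` of `𝓞 L` is unramified
over `ℤ`. Then `|d_K| ≤ 1944·N²`: `v₂(d_K) ≤ 3`, `v₃(d_K) ≤ 5` (part I), `v_p(d_K) ≤ 2` for `p ≥ 5`
(tame, part I), and `p ∣ d_K ⇒ p` ramifies in `K ⇒` in `L ⇒ p ∣ N`; then `|d_K| ∣ 2³·3⁵·N²`.
Applied with `L = ℚ(E[2])`, `N = N_E` (Néron–Ogg–Shafarevich) this is the cubic clause of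
`ResolventDiscBounds`. [cite: NeukirchANT1999, Ch. III (2.6), (2.11)] -/
theorem abs_discr_le_of_cubic_of_unramified (hK : Module.finrank ℚ K = 3) {N : ℕ} (hN : N ≠ 0)
    (hur : ∀ p : ℕ, p.Prime → 5 ≤ p → ¬ p ∣ N →
      ∀ (Q : Ideal (𝓞 L)) [Q.IsMaximal], (p : 𝓞 L) ∈ Q → Q.ramificationIdx ℤ = 1) :
    |(discr K : ℝ)| ≤ 1944 * (N : ℝ) ^ (2 : ℕ) := by
  have hd : (discr K).natAbs ≠ 0 := Int.natAbs_ne_zero.mpr (discr_ne_zero K)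
  have hdvd : (discr K).natAbs ∣ 1944 * N ^ 2 := by
    refine dvd_mul_sq_of_padicValNat_le hd hN
      (padicValNat_two_discr_le_three K (by omega))
      (padicValNat_three_discr_le_five K (by omega)) (fun p hp h5 => ?_) (fun p hp h5 hpd => ?_)
    · have := padicValNat_discr_le_of_finrank_lt K hp (by omega)
      omega
    · by_contra hpN
      exact not_dvd_discr_of_forall_ramificationIdx_eq_one_of_algebra K L hp
        (fun Q _ hQ => hur p hp h5 hpN Q hQ) (Int.natCast_dvd.mpr hpd)
  have := abs_discr_le_of_natAbs_dvd K (by positivity) hdvd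
  exact_mod_cast this

/-- **Quadratic engine.** Let `K ⊆ L` be number fields with `[K:ℚ] = 2` and `N ≠ 0` such that for
every prime `p ≥ 3` with `p ∤ N` every maximal ideal `Q ∋ p` of `𝓞 L` is unramified over `ℤ`. Then
`|d_K| ≤ 8·N` (`v₂(d_K) ≤ 3`; `v_p(d_K) ≤ 1` for odd `p`, tame; odd `p ∣ d_K ⇒ p ∣ N`).
Applied with `L = ℚ(E[2])`, `N = N_E` this is the quadratic clause of `ResolventDiscBounds`.
[cite: NeukirchANT1999, Ch. III (2.6), (2.11)] -/
theorem abs_discr_le_of_quadratic_of_unramified (hK : Module.finrank ℚ K = 2) {N : ℕ}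
    (hN : N ≠ 0)
    (hur : ∀ p : ℕ, p.Prime → 3 ≤ p → ¬ p ∣ N →
      ∀ (Q : Ideal (𝓞 L)) [Q.IsMaximal], (p : 𝓞 L) ∈ Q → Q.ramificationIdx ℤ = 1) :
    |(discr K : ℝ)| ≤ 8 * (N : ℝ) := by
  have hd : (discr K).natAbs ≠ 0 := Int.natAbs_ne_zero.mpr (discr_ne_zero K)
  have hdvd : (discr K).natAbs ∣ 8 * N := by
    refine dvd_mul_of_padicValNat_le hd hN
      (padicValNat_two_discr_le_three K (by omega)) (fun p hp h3 => ?_) (fun p hp h3 hpd => ?_)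
    · have := padicValNat_discr_le_of_finrank_lt K hp (by omega)
      omega
    · by_contra hpN
      exact not_dvd_discr_of_forall_ramificationIdx_eq_one_of_algebra K L hp
        (fun Q _ hQ => hur p hp h3 hpN Q hQ) (Int.natCast_dvd.mpr hpd)
  have := abs_discr_le_of_natAbs_dvd K (by positivity) hdvd
  exact_mod_cast this

end Engine

/-! ### §5. Abstract embedding -/

/-- **Embedding a prime-degree field.** Let `K` be a number field of prime degree `[K:ℚ]`, `θ ∈ K`
irrational with `f(θ) = 0` for some `f ≠ 0` in `ℚ[X]`, and `M` a field over `ℚ` over which `f`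
splits. Then `K` embeds into `M` over `ℚ`: `ℚ(θ) = K` because the lattice of intermediate fields of
a prime-degree extension is `{⊥, ⊤}` (Mathlib `IntermediateField.isSimpleOrder_of_finrank_prime`) and
`θ ∉ ℚ`; the minimal polynomial of `θ` divides `f`, so it splits in `M`, and the embedding exists by
extension of embeddings (Mathlib `IntermediateField.nonempty_algHom_of_adjoin_splits`). Used with
`[K:ℚ] ∈ {2, 3}`, `f` the 2-division cubic and `M = ℚ(E[2])`. [cite: Lang2002, Ch. V §2] -/
theorem nonempty_algHom_of_finrank_prime {M : Type*} [Field M] [Algebra ℚ M]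
    (hK : (Module.finrank ℚ K).Prime) {f : ℚ[X]} (hf : f ≠ 0) (θ : K) (hθ : aeval θ f = 0)
    (hirr : ∀ q : ℚ, θ ≠ algebraMap ℚ K q) (hsplit : (f.map (algebraMap ℚ M)).Splits) :
    Nonempty (K →ₐ[ℚ] M) := by
  haveI := IntermediateField.isSimpleOrder_of_finrank_prime ℚ K hK
  have htop : IntermediateField.adjoin ℚ {θ} = ⊤ := by
    rcases IsSimpleOrder.eq_bot_or_eq_top (IntermediateField.adjoin ℚ {θ}) with h | h
    · exfalso
      have hmem : θ ∈ (⊥ : IntermediateField ℚ K) := by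
        rw [← h]; exact IntermediateField.subset_adjoin ℚ {θ} (Set.mem_singleton θ)
      rw [IntermediateField.mem_bot] at hmem
      obtain ⟨q, hq⟩ := hmem
      exact hirr q hq.symm
    · exact h
  refine IntermediateField.nonempty_algHom_of_adjoin_splits (fun s hs => ?_) htop
  rw [Set.mem_singleton_iff] at hs
  subst hs
  refine ⟨Algebra.IsIntegral.isIntegral s, ?_⟩
  have hdvd : minpoly ℚ s ∣ f := minpoly.dvd ℚ s hθ
  exact Polynomial.Splits.of_dvd hsplit ((Polynomial.map_ne_zero_iff (algebraMap ℚ M).injective).mpr hf)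
    (Polynomial.map_dvd (algebraMap ℚ M) hdvd)

/-- A root in `K` of an irreducible `f ∈ ℚ[X]` of degree `≠ 1` is irrational (an irreducible
polynomial with a rational root is linear, Mathlib `Irreducible.not_isRoot_of_natDegree_ne_one`).
[folklore] -/
theorem ne_algebraMap_of_irreducible {f : ℚ[X]} (hf : Irreducible f) (hdeg : f.natDegree ≠ 1)
    {θ : K} (hθ : aeval θ f = 0) (q : ℚ) : θ ≠ algebraMap ℚ K q := by
  rintro rfl
  refine hf.not_isRoot_of_natDegree_ne_one hdeg (x := q) ?_
  rw [aeval_algebraMap_apply_eq_algebraMap_eval,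
    map_eq_zero_iff _ (algebraMap ℚ K).injective] at hθ
  exact hθ

/-! ### §6. Final engines in the shape of the route decl -/

variable (L : Type*) [Field L] [NumberField L]

/-- **Cubic clause engine, route shape.** `K` a number field with `[K:ℚ] = 3` containing a root `θ`
of an irreducible `f ∈ ℚ[X]` of degree `≠ 1`; `L` a number field over which `f` splits; `N ≠ 0` such
that for every prime `p ≥ 5`, `p ∤ N`, every maximal ideal `Q ∋ p` of `𝓞 L` has `e(Q|p) = 1`. Then
`|(d_K : ℝ)| ≤ 1944·N²`. (Embed `K ↪ L` by `nonempty_algHom_of_finrank_prime`, then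
`abs_discr_le_of_cubic_of_unramified`.) For `ResolventDiscBounds`: `f` = the 2-division cubic of
`E/ℚ`, `L = ℚ(E[2])`, `N = N_E`. [cite: NeukirchANT1999, Ch. III (2.6), (2.11)] -/
theorem abs_discr_le_of_cubic_root (hK : Module.finrank ℚ K = 3) {f : ℚ[X]} (hf : Irreducible f)
    (hf1 : f.natDegree ≠ 1) {θ : K} (hθ : aeval θ f = 0)
    (hsplit : (f.map (algebraMap ℚ L)).Splits) {N : ℕ} (hN : N ≠ 0)
    (hur : ∀ p : ℕ, p.Prime → 5 ≤ p → ¬ p ∣ N →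
      ∀ (Q : Ideal (𝓞 L)) [Q.IsMaximal], (p : 𝓞 L) ∈ Q → Q.ramificationIdx ℤ = 1) :
    |(discr K : ℝ)| ≤ 1944 * (N : ℝ) ^ (2 : ℕ) := by
  obtain ⟨φ⟩ := nonempty_algHom_of_finrank_prime K (hK ▸ Nat.prime_three) hf.ne_zero θ hθ
    (ne_algebraMap_of_irreducible K hf hf1 hθ) hsplit
  letI : Algebra K L := φ.toRingHom.toAlgebra
  exact abs_discr_le_of_cubic_of_unramified K L hK hN hur

/-- **Quadratic clause engine, route shape.** `K` a number field with `[K:ℚ] = 2` containing an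
irrational root `θ` of some `f ≠ 0` in `ℚ[X]`; `L` a number field over which `f` splits; `N ≠ 0`
such that for every prime `p ≥ 3`, `p ∤ N`, every maximal ideal `Q ∋ p` of `𝓞 L` has `e(Q|p) = 1`.
Then `|(d_K : ℝ)| ≤ 8·N`. For `ResolventDiscBounds`: `f` = the 2-division cubic, `L = ℚ(E[2])`,
`N = N_E`. [cite: NeukirchANT1999, Ch. III (2.6), (2.11)] -/
theorem abs_discr_le_of_quadratic_root (hK : Module.finrank ℚ K = 2) {f : ℚ[X]} (hf : f ≠ 0)
    {θ : K} (hθ : aeval θ f = 0) (hirr : ∀ q : ℚ, θ ≠ algebraMap ℚ K q)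
    (hsplit : (f.map (algebraMap ℚ L)).Splits) {N : ℕ} (hN : N ≠ 0)
    (hur : ∀ p : ℕ, p.Prime → 3 ≤ p → ¬ p ∣ N →
      ∀ (Q : Ideal (𝓞 L)) [Q.IsMaximal], (p : 𝓞 L) ∈ Q → Q.ramificationIdx ℤ = 1) :
    |(discr K : ℝ)| ≤ 8 * (N : ℝ) := by
  obtain ⟨φ⟩ := nonempty_algHom_of_finrank_prime K (hK ▸ Nat.prime_two) hf θ hθ hirr hsplit
  letI : Algebra K L := φ.toRingHom.toAlgebra
  exact abs_discr_le_of_quadratic_of_unramified K L hK hN hur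

end Summit.ABC.ABC.Theorems

end
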